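import Summits.CriticalPhenomena.CardyFormulaZ2.Theorems.CardySelfDualSegmentUniformMarginalityDefs

/-!
# Arcs of `ε₀`-close marked loops are `η`-close (sub-stub N1 of `stub_fixedDomainContinuity_one`, line `Sketch`,
crux `UniformMarginality`, stmt-CriticalPhenomena-5472)

For a conformal rectangle `R` and `η > 0` there is `ε₀ > 0` such that every conformal rectangle `Q` whose boundary
loop is pointwise `ε₀`-close to that of `R` and whose mark parameters are `ε₀`-close has each arc `Q.arc i` inside the
closed `η`-fattening of `R.arc i` AND vice versa (uniform continuity of `R.boundary` on a compact parameter window;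
clamp the parameter of one arc into the parameter interval of the other).
-/

noncomputable section

namespace Summit.CriticalPhenomena.CardyFormulaZ2.Cruxes.UniformMarginality.HeatFlow

open Set Metric
open Literature.Probability.RandomPlanarGeometry

/-- Closeness of the marks transfers to closeness of the (cyclic) next marks. -/
private theorem abs_nextMark_sub_nextMark_le {Q R : ConformalRectangle} {ε₀ : ℝ}
    (hm : ∀ i : Fin 4, |Q.mark i - R.mark i| ≤ ε₀) (i : Fin 4) :
    |Q.nextMark i - R.nextMark i| ≤ ε₀ := by
  unfold MarkedDomain.nextMark
  split_ifs with h
  · exact hm ⟨i.val + 1, h⟩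
  · rw [add_sub_add_right_eq_sub]
    exact hm ⟨0, by omega⟩

/-- The parameter interval of an arc lies in the window `[0, 2]` (marks are in `[0, 1)` and the
next mark is at most one period later). -/
private theorem Icc_mark_nextMark_subset (D : ConformalRectangle) (i : Fin 4) :
    Icc (D.mark i) (D.nextMark i) ⊆ Icc (0 : ℝ) 2 := by
  intro t ht
  have h0 := (D.mark_mem i).1
  have h1 := (D.mark_mem i).2
  have h2 := D.nextMark_le_mark_add_one i
  exact ⟨h0.trans ht.1, by linarith [ht.2]⟩

/-- Clamping argument: if the endpoints of `[a, b]` are `ε₀`-close to those of `[a', b']` and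
`f t` is `η`-close to `g t'` whenever `t ∈ [a, b]`, `t' ∈ [a', b']` are `ε₀`-close, then
`f '' [a, b]` lies in the closed `η`-thickening of `g '' [a', b']`. -/
private theorem image_Icc_subset_cthickening_image_Icc {f g : ℝ → ℂ} {a b a' b' ε₀ η : ℝ}
    (hab' : a' ≤ b') (ha : |a - a'| ≤ ε₀) (hb : |b - b'| ≤ ε₀)
    (hclose : ∀ t ∈ Icc a b, ∀ t' ∈ Icc a' b', |t - t'| ≤ ε₀ → dist (f t) (g t') ≤ η) :
    f '' Icc a b ⊆ Metric.cthickening η (g '' Icc a' b') := by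
  rintro _ ⟨t, ht, rfl⟩
  have hε : 0 ≤ ε₀ := (abs_nonneg _).trans ha
  obtain ⟨ha1, -⟩ := abs_le.1 ha
  obtain ⟨-, hb2⟩ := abs_le.1 hb
  have ht' : max a' (min t b') ∈ Icc a' b' := ⟨le_max_left _ _, max_le hab' (min_le_right _ _)⟩
  have htt' : |t - max a' (min t b')| ≤ ε₀ := by
    rw [abs_le]
    constructor
    · have : max a' (min t b') ≤ t + ε₀ :=
        max_le (by linarith [ht.1]) ((min_le_left _ _).trans (by linarith))
      linarith
    · have : t - ε₀ ≤ max a' (min t b') :=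
        le_trans (le_min (by linarith) (by linarith [ht.2])) (le_max_right _ _)
      linarith
  exact Metric.mem_cthickening_of_dist_le _ _ _ _ ⟨_, ht', rfl⟩ (hclose t ht _ ht' htt')

/-- SUB-STUB (N1) of `stub_fixedDomainContinuity_one`: **arcs of close marked loops are close, both ways.**
For `η > 0` there is `ε₀ > 0` such that pointwise `ε₀`-closeness of the boundary loops (in `R`'s parametrisation)
and `ε₀`-closeness of the four mark parameters give `Q.arc i ⊆ (R.arc i)_{+η}` and `R.arc i ⊆ (Q.arc i)_{+η}` for
every `i`. -/
theorem stub_arcs_close_of_loop_close :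
    ∀ (R : ConformalRectangle) (η : ℝ), 0 < η → ∃ ε₀ > 0, ∀ Q : ConformalRectangle,
      (∀ u : ℝ, dist (Q.boundary u) (R.boundary u) ≤ ε₀) → (∀ i : Fin 4, |Q.mark i - R.mark i| ≤ ε₀) →
      ∀ i : Fin 4, Q.arc i ⊆ Metric.cthickening η (R.arc i) ∧ R.arc i ⊆ Metric.cthickening η (Q.arc i) := by
  intro R η hη
  -- Heine–Cantor: `R.boundary` is uniformly continuous on the compact parameter window `[0, 2]`.
  obtain ⟨τ, hτ, hR⟩ := Metric.uniformContinuousOn_iff_le.1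
    ((isCompact_Icc : IsCompact (Icc (0 : ℝ) 2)).uniformContinuousOn_of_continuous
      R.continuous_boundary.continuousOn) (η / 2) (by positivity)
  obtain ⟨ε₀, hε₀, hεη, hετ⟩ : ∃ ε₀ : ℝ, 0 < ε₀ ∧ ε₀ ≤ η / 2 ∧ ε₀ ≤ τ :=
    ⟨min (η / 2) τ, lt_min (by positivity) hτ, min_le_left _ _, min_le_right _ _⟩
  refine ⟨ε₀, hε₀, fun Q hQ hm i => ?_⟩
  have hnm := abs_nextMark_sub_nextMark_le hm i
  unfold MarkedDomain.arc
  constructor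
  · refine image_Icc_subset_cthickening_image_Icc (R.mark_lt_nextMark i).le (hm i) hnm
      fun t ht t' ht' htt' => ?_
    calc dist (Q.boundary t) (R.boundary t')
        ≤ dist (Q.boundary t) (R.boundary t) + dist (R.boundary t) (R.boundary t') :=
          dist_triangle _ _ _
      _ ≤ ε₀ + η / 2 :=
          add_le_add (hQ t) (hR t (Icc_mark_nextMark_subset Q i ht) t'
            (Icc_mark_nextMark_subset R i ht') (by rw [Real.dist_eq]; exact htt'.trans hετ))
      _ ≤ η := by linarith
  · refine image_Icc_subset_cthickening_image_Icc (ε₀ := ε₀) (Q.mark_lt_nextMark i).le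
      ((abs_sub_comm _ _).trans_le (hm i)) ((abs_sub_comm _ _).trans_le hnm)
      fun t ht t' ht' htt' => ?_
    calc dist (R.boundary t) (Q.boundary t')
        ≤ dist (R.boundary t) (R.boundary t') + dist (R.boundary t') (Q.boundary t') :=
          dist_triangle _ _ _
      _ ≤ η / 2 + ε₀ :=
          add_le_add (hR t (Icc_mark_nextMark_subset R i ht) t'
            (Icc_mark_nextMark_subset Q i ht') (by rw [Real.dist_eq]; exact htt'.trans hετ))
            (by rw [dist_comm]; exact hQ t')
      _ ≤ η := by linarith

end Summit.CriticalPhenomena.CardyFormulaZ2.Cruxes.UniformMarginality.HeatFlow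

end
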